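import Summits.BirchSwinnertonDyer.BirchSwinnertonDyer.Theses.ByReductionTypeAtTwo
import Summits.BirchSwinnertonDyer.BirchSwinnertonDyer.Theorems.ByReductionTypeAtTwoSupersingularSharpTwo
import Summits.BirchSwinnertonDyer.Rank1Residual.P2.EmptyCellsAtTwo
import HarnessLib

/-!
# Route `ByReductionTypeAtTwo` (rung K4), crux `SupersingularRankZeroAtTwo` (item
# stmt-BirchSwinnertonDyer-19097): the two MILLER HALVES at `a₂ = 0` from ONE-SIDED signed
# divisibilities at `p = 2` on REAL objects, and the refined class-level form (seat `bsd-2adic-ss-1`)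

HONEST FRAMING (cell `bsd-2adic`, run/shared/lean/pub/bsd-2adic/, HUMAN RULINGS D-0036/D-0059/D-0074):
THEOREMS ONLY, against the REGISTERED crux constant and the BC3 skeleton's stubs `stub_upper` /
`stub_lower` (`MissingUpperBoundAt W 2` / `MissingLowerBoundAt W 2`); every research input an explicit
hypothesis; no definition, no named fact; nothing booked. PARTITION (D-0054): X5@2 good-ss (B1·O1;
763 book230 classes) × p = 2 — types-the-object-of; closes none. Companion of
`ByReductionTypeAtTwoSupersingularInputs.lean` (there: the main-conjecture EQUALITY
`KobayashiMainConjecture W 2 1`; here: its two ONE-SIDED halves separately, each weaker).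

## Contents (`a₂ = 0`, REAL objects `X⁺(E/ℚ_∞)` = `Kobayashi2003.SignedSelmerDualData W κ γ 1` and
## Pollack's/Sprung's `L♭ = L⁻` at `2`, which EXISTS: `exists_isPollackPair_two`)

* `missingLowerBoundAt_two_of_kobayashiLowerDivisibility_two` — **the Eisenstein half at `2`**:
  PUB {modularity, GZK} + typed {Kobayashi Thm. 1.2 at `2` (`h12`: `X⁺` f.g. torsion), Kim Cor. 3.15 at
  `2` (`hKim`), THE TREE'S TYPED `KobayashiLowerDivisibility W 2 1` (`char X⁺ = (g)`, `ι g = ϖ·ι(L♭·h)`)}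
  ⇒ `ord₂ #Ш_an ≤ ord₂ #Ш`. The `p = 2` twin of the tree's odd-`p`
  `missingLowerBoundAt_of_kobayashiLowerDivisibility`; at `2` the `♭` constant is `1`, so `g(0) = t·h(0)`
  with `t = L(E,1)/Ω_E` and `v₂ h(0) ≥ 0`.
* `missingUpperBoundAt_two_of_signedUpperDivisibility_two` — **the Kato half at `2`**: the same with
  the REVERSED divisibility `ι(g·h) = ϖ·ι L♭` (Kobayashi Thm. 4.1 shape in the Néron normalisation;
  at `2` NOT in print — typed inline) ⇒ `ord₂ #Ш ≤ ord₂ #Ш_an`.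
* `supersingularRankZeroAtTwo_of_signedHalves_two` — THE REFINED CLASS-LEVEL FORM: on `a₂ = 0` the
  two one-sided signed divisibilities at `2` (+ `h12`, `hKim`), on `a₂ = ±2` the two Miller halves
  themselves (MATH-BOUND: no signed object at `2`, Sprung 2012 §7 "`p` odd") ⇒ the crux, via
  `supersingularRankZeroAtTwo_of_halves`-style composition (`missingPPartAt_of_lower_of_upper`).

References: [Kobayashi2003] Thm. 1.2, Thm. 4.1, (3.6), Conjecture p. 2; [BDKim2013] Cor. 3.15;
[Sprung2012] §7; [Sprung2017] §1.1, Cor. 4.11; [Miller2011LMS] Def. 1.1.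
-/

set_option autoImplicit false
-- the Theorems namespace of this sub repeats the summit name by design (D-0017 nested layout)
set_option linter.dupNamespace false

noncomputable section

open scoped Classical MatrixGroups ModularForm

open CongruenceSubgroup WeierstrassCurve Literature.NumberTheory.EllipticCurves
  Literature.NumberTheory.EllipticCurves.ModularForms Literature.NumberTheory.EllipticCurves.Sprung2017
  Literature.NumberTheory.EllipticCurves.Rank1Residual Literature.NumberTheory.EllipticCurves.Rank1Residual.Typed
  Literature.NumberTheory.EllipticCurves.Kobayashi2003 ZpExtension
  Summit.BirchSwinnertonDyer.Rank1Residual Summit.BirchSwinnertonDyer.Rank1Residual.Supersingular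

namespace Summit.BirchSwinnertonDyer.BirchSwinnertonDyer.Theorems

section Halves

variable (W : WeierstrassCurve ℚ) [W.IsElliptic] [W.IsGloballyMinimal]

/-- Shared bookkeeping at `a₂ = 0`, `p = 2`: from modularity, a signed one-sided datum at `2` and the
`♭` constant `c♭ = 1`, produce `t = L(E,1)/Ω_E ∈ ℚ` (`t ≠ 0`), a generator `g` of `char X⁺` with Kim's
valuation `v₂ g(0) = v₂ ∏c + v₂ #Ш`, and `h ∈ Λ` with EITHER `g(0) = t·h(0)` (lower shape, `low = true`)
OR `g(0)·h(0) = t` (upper shape, `low = false`). Internal lemma; nothing asserted.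
[cite: Kobayashi2003, (3.6) and Conjecture (p. 2)] [cite: BDKim2013, Cor. 3.15 (p. 199)] -/
theorem exists_generator_of_signedDivisibility_two
    (hmod : nonempty_modularParametrizationData)
    (hGZK : rank_eq_analyticRank_of_analyticRank_le_one)
    (hgood : W.HasGoodReductionAtPrime 2) (ha : W.frobeniusTrace 2 = 0)
    (hL : W.entireLFunction 1 ≠ 0)
    (h12 : ∀ (κ : ZpExtension ℚ 2) (γ : Field.absoluteGaloisGroup ℚ),
      κ.IsCyclotomic → κ.IsTopGenerator γ →
      ∀ D : SignedSelmerDualData W κ γ 1,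
        Module.Finite (IwasawaAlgebra 2) D.X ∧ Module.IsTorsion (IwasawaAlgebra 2) D.X)
    (hKim : ∀ (κ : ZpExtension ℚ 2) (γ : Field.absoluteGaloisGroup ℚ),
      κ.IsCyclotomic → κ.IsTopGenerator γ →
      ∀ (D : SignedSelmerDualData W κ γ 1) [Module.Finite (IwasawaAlgebra 2) D.X],
        Module.IsTorsion (IwasawaAlgebra 2) D.X →
      ∀ g : IwasawaAlgebra 2, D.charIdeal = Ideal.span {g} → Finite (W.selmerGroupPInfty 2) →
        ∃ u : ℤ_[2]ˣ, ((PowerSeries.constantCoeff g : ℤ_[2]) : ℚ_[2]) =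
          ((u : ℤ_[2]) : ℚ_[2]) * ((2 : ℕ) : ℚ_[2]) ^ (padicValNat 2 W.tamagawaProduct) *
            (Nat.card (W.selmerGroupPInfty 2) : ℚ_[2]))
    (low : Bool)
    (hdiv : ∀ (κ : ZpExtension ℚ 2) (γ : Field.absoluteGaloisGroup ℚ),
      κ.IsCyclotomic → κ.IsTopGenerator γ → IsCyclotomicVariable 2 γ →
      ∀ [NeZero (W.conductorNorm ℤ)] (f : CuspForm (Gamma0 (W.conductorNorm ℤ)) 2),
        IsNewformOf W f → ∀ (ϖ : ℚ), (ϖ : ℝ) * W.realPeriodRat = plusPeriod f →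
      ∀ (Lplus Lminus : IwasawaAlgebra 2), IsPollackPair f 2 Lplus Lminus →
      ∀ (D : SignedSelmerDualData W κ γ 1),
        ∃ g h : IwasawaAlgebra 2, D.charIdeal = Ideal.span {g} ∧
          (if low then iwasawaToPowerSeries 2 g =
              PowerSeries.C (ϖ : ℚ_[2]) * iwasawaToPowerSeries 2 (kobayashiL 1 Lplus Lminus * h)
           else iwasawaToPowerSeries 2 (g * h) =
              PowerSeries.C (ϖ : ℚ_[2]) * iwasawaToPowerSeries 2 (kobayashiL 1 Lplus Lminus))) :
    ∃ t : ℚ, t ≠ 0 ∧ W.entireLFunction 1 / (W.realPeriodRat : ℂ) = (t : ℂ) ∧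
      ∃ g h : IwasawaAlgebra 2,
        (((PowerSeries.constantCoeff g : ℤ_[2]) : ℚ_[2])).valuation =
          (padicValNat 2 W.tamagawaProduct : ℤ) + padicValNat 2 W.shaOrder ∧
        ((PowerSeries.constantCoeff g : ℤ_[2]) : ℚ_[2]) ≠ 0 ∧
        (if low then ((PowerSeries.constantCoeff g : ℤ_[2]) : ℚ_[2]) =
            ((t : ℚ) : ℚ_[2]) * ((PowerSeries.constantCoeff h : ℤ_[2]) : ℚ_[2])
         else ((PowerSeries.constantCoeff g : ℤ_[2]) : ℚ_[2]) *
            ((PowerSeries.constantCoeff h : ℤ_[2]) : ℚ_[2]) = ((t : ℚ) : ℚ_[2])) := by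
  -- modularity: the newform `f` of `E` and the period ratio `ϖ`
  haveI : NeZero (W.conductorNorm ℤ) := ⟨(W.conductorNorm_pos_holds).ne'⟩
  obtain ⟨Dm⟩ := hmod W
  set f := Dm.f with hf_def
  have hf : IsNewformOf W f := Dm.isNewformOf
  obtain ⟨ϖ, hϖpos, hϖeq, hΩpos⟩ := Dm.exists_rat_mul_realPeriodRat_eq_plusPeriod
  set s : ℚ := ratPlusSymbol f 0 with hs_def
  set t : ℚ := ϖ * s with ht_def
  have hLval : W.entireLFunction 1 = (((s : ℝ) * plusPeriod f : ℝ) : ℂ) := hf.entireLFunction_one_eq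
  have ht : W.entireLFunction 1 / (W.realPeriodRat : ℂ) = ((t : ℚ) : ℂ) := by
    rw [hLval, ← hϖeq, div_eq_iff (Complex.ofReal_ne_zero.mpr hΩpos.ne'), ht_def]
    push_cast
    ring
  have hs0 : s ≠ 0 := by
    intro h0
    apply hL
    rw [hLval, h0]
    simp
  have ht0 : t ≠ 0 := mul_ne_zero hϖpos.ne' hs0
  -- cyclotomic data, the Pollack pair at `2`, the dual datum of `Sel⁺(E/ℚ_∞)`
  obtain ⟨κ, hκ, γ, hγ, hγ'⟩ := exists_isCyclotomic_isTopGenerator_isCyclotomicVariable_holds 2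
  obtain ⟨Ls, Lf, hSP, hPP⟩ := exists_isPollackPair_two hf hgood ha hL
  obtain ⟨D⟩ := nonempty_signedSelmerDualData W κ (1 : ℤˣ) hγ
  obtain ⟨hFin, hTors⟩ := h12 κ γ hκ hγ D
  haveI := hFin
  obtain ⟨g, h, hchar, hgh⟩ := hdiv κ γ hκ hγ hγ' f hf ϖ hϖeq Ls Lf hPP D
  have hkL : kobayashiL (1 : ℤˣ) Ls Lf = Lf := by unfold kobayashiL; rw [if_pos rfl]
  rw [hkL] at hgh
  -- Kim at `2` for `ξ := g`
  have hK : (⟨g, 0, 0⟩ : SignedDatum W 2).EulerCharacteristic := fun hfin ↦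
    hKim κ γ hκ hγ D hTors g hchar hfin
  obtain ⟨hg0ne, hvg⟩ := valuation_constantCoeff_xi W 2 hGZK hL ⟨g, 0, 0⟩ hK
  -- the `♭` constant at `2`, `a₂ = 0`: `L♭(0) = [0]⁺_f`, so `ϖ · L♭(0) = t`
  have hLf0 := constantCoeff_flat_two_of_isSprungPair_of_isNewformOf hf hgood hSP
  rw [ha] at hLf0
  have hϖLf : (ϖ : ℚ_[2]) * ((PowerSeries.constantCoeff Lf : ℤ_[2]) : ℚ_[2]) = ((t : ℚ) : ℚ_[2]) := by
    rw [hLf0, ht_def]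
    push_cast
    ring
  refine ⟨t, ht0, ht, g, h, hvg, hg0ne, ?_⟩
  cases low with
  | true =>
    simp only [if_true] at hgh ⊢
    have hc := congrArg PowerSeries.constantCoeff hgh
    rw [constantCoeff_iwasawaToPowerSeries, map_mul, PowerSeries.constantCoeff_C,
      constantCoeff_iwasawaToPowerSeries, map_mul, PadicInt.coe_mul, ← mul_assoc, hϖLf] at hc
    exact hc
  | false =>
    simp only [Bool.false_eq_true, if_false] at hgh ⊢
    have hc := congrArg PowerSeries.constantCoeff hgh
    rw [constantCoeff_iwasawaToPowerSeries, map_mul, PadicInt.coe_mul, map_mul,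
      PowerSeries.constantCoeff_C, constantCoeff_iwasawaToPowerSeries, hϖLf] at hc
    exact hc

/-- **The Eisenstein half at `p = 2`, `a₂ = 0`, on REAL objects.** PUB {modularity `hmod`, GZK
`hGZK`} + typed {Kobayashi Thm. 1.2 at `2` (`h12`), Kim Cor. 3.15 at `2` (`hKim`), THE TREE'S
`KobayashiLowerDivisibility W 2 1` (`hdiv`)} ⇒ `ord₂ #Ш_an ≤ ord₂ #Ш` (`MissingLowerBoundAt W 2`) for
`E = W` good at `2` with `a₂ = 0`, `L(E,1) ≠ 0`. Chain: `g(0) = t·h(0)`, `v₂ h(0) ≥ 0`, so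
`v₂ t ≤ v₂ g(0) = v₂ ∏c + v₂ #Ш`; `E(ℚ)[2] = 0` (`P2.irr_two_of_goodSS_two`).
[cite: Kobayashi2003, Thm. 1.2 and Conjecture (p. 2)] [cite: BDKim2013, Cor. 3.15 (p. 199)]
[cite: Miller2011LMS, Def. 1.1] -/
theorem missingLowerBoundAt_two_of_kobayashiLowerDivisibility_two
    (hmod : nonempty_modularParametrizationData)
    (hGZK : rank_eq_analyticRank_of_analyticRank_le_one)
    (hgood : W.HasGoodReductionAtPrime 2) (ha : W.frobeniusTrace 2 = 0)
    (hL : W.entireLFunction 1 ≠ 0)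
    (h12 : ∀ (κ : ZpExtension ℚ 2) (γ : Field.absoluteGaloisGroup ℚ),
      κ.IsCyclotomic → κ.IsTopGenerator γ →
      ∀ D : SignedSelmerDualData W κ γ 1,
        Module.Finite (IwasawaAlgebra 2) D.X ∧ Module.IsTorsion (IwasawaAlgebra 2) D.X)
    (hKim : ∀ (κ : ZpExtension ℚ 2) (γ : Field.absoluteGaloisGroup ℚ),
      κ.IsCyclotomic → κ.IsTopGenerator γ →
      ∀ (D : SignedSelmerDualData W κ γ 1) [Module.Finite (IwasawaAlgebra 2) D.X],
        Module.IsTorsion (IwasawaAlgebra 2) D.X →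
      ∀ g : IwasawaAlgebra 2, D.charIdeal = Ideal.span {g} → Finite (W.selmerGroupPInfty 2) →
        ∃ u : ℤ_[2]ˣ, ((PowerSeries.constantCoeff g : ℤ_[2]) : ℚ_[2]) =
          ((u : ℤ_[2]) : ℚ_[2]) * ((2 : ℕ) : ℚ_[2]) ^ (padicValNat 2 W.tamagawaProduct) *
            (Nat.card (W.selmerGroupPInfty 2) : ℚ_[2]))
    (hdiv : KobayashiLowerDivisibility W 2 1) : MissingLowerBoundAt W 2 := by
  have hr : W.analyticRank = 0 := analyticRank_eq_zero_of_entireLFunction_one_ne_zero W hL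
  have hirr : W.HasIrreducibleModPGaloisRep 2 :=
    P2.irr_two_of_goodSS_two W ⟨hgood, by rw [ha]; exact dvd_zero _⟩
  obtain ⟨t, ht0, ht, g, h, hvg, hg0ne, hgh⟩ := exists_generator_of_signedDivisibility_two W hmod hGZK
    hgood ha hL h12 hKim true
    (fun κ γ hκ hγ hγ' _ f hf ϖ hϖ Lp Lm hPP D ↦ by
      simpa only [if_true] using hdiv κ γ hκ hγ hγ' f hf ϖ hϖ Lp Lm hPP D)
  simp only [if_true] at hgh
  have htQ : ((t : ℚ) : ℚ_[2]) ≠ 0 := by exact_mod_cast ht0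
  have hh0 : ((PowerSeries.constantCoeff h : ℤ_[2]) : ℚ_[2]) ≠ 0 := fun h0 ↦
    hg0ne (by rw [hgh, h0, mul_zero])
  have hval := congrArg Padic.valuation hgh
  rw [Padic.valuation_mul htQ hh0, Padic.valuation_ratCast, hvg] at hval
  have hhnn := valuation_coe_padicInt_nonneg _ hh0
  refine ⟨t * (W.torsionOrder : ℚ) ^ 2 / (W.tamagawaProduct : ℚ),
    shaAn_eq_of_analyticRank_eq_zero W hGZK hr ht, ?_⟩
  rw [padicValRat_shaAn_witness W 2 hirr ht0]
  linarith

/-- **The Kato half at `p = 2`, `a₂ = 0`, on REAL objects.** PUB {modularity, GZK} + typed {Kobayashi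
Thm. 1.2 at `2` (`h12`), Kim Cor. 3.15 at `2` (`hKim`), the Kato-side divisibility at `2` in the Néron
normalisation (`hdiv`: `char X⁺ = (g)` and `ι(g·h) = ϖ·ι L♭` over every Pollack pair at `2` — the
shape of Kobayashi Thm. 4.1 with `n = 0`, NOT in print at `2`, typed inline)} ⇒ `ord₂ #Ш ≤ ord₂ #Ш_an`
(`MissingUpperBoundAt W 2`). Chain: `g(0)·h(0) = t`, so `v₂ ∏c + v₂ #Ш = v₂ g(0) ≤ v₂ t`.
[cite: Kobayashi2003, Thm. 1.2 and Thm. 4.1 (p. 8)] [cite: BDKim2013, Cor. 3.15 (p. 199)]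
[cite: Miller2011LMS, Def. 1.1] -/
theorem missingUpperBoundAt_two_of_signedUpperDivisibility_two
    (hmod : nonempty_modularParametrizationData)
    (hGZK : rank_eq_analyticRank_of_analyticRank_le_one)
    (hgood : W.HasGoodReductionAtPrime 2) (ha : W.frobeniusTrace 2 = 0)
    (hL : W.entireLFunction 1 ≠ 0)
    (h12 : ∀ (κ : ZpExtension ℚ 2) (γ : Field.absoluteGaloisGroup ℚ),
      κ.IsCyclotomic → κ.IsTopGenerator γ →
      ∀ D : SignedSelmerDualData W κ γ 1,
        Module.Finite (IwasawaAlgebra 2) D.X ∧ Module.IsTorsion (IwasawaAlgebra 2) D.X)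
    (hKim : ∀ (κ : ZpExtension ℚ 2) (γ : Field.absoluteGaloisGroup ℚ),
      κ.IsCyclotomic → κ.IsTopGenerator γ →
      ∀ (D : SignedSelmerDualData W κ γ 1) [Module.Finite (IwasawaAlgebra 2) D.X],
        Module.IsTorsion (IwasawaAlgebra 2) D.X →
      ∀ g : IwasawaAlgebra 2, D.charIdeal = Ideal.span {g} → Finite (W.selmerGroupPInfty 2) →
        ∃ u : ℤ_[2]ˣ, ((PowerSeries.constantCoeff g : ℤ_[2]) : ℚ_[2]) =
          ((u : ℤ_[2]) : ℚ_[2]) * ((2 : ℕ) : ℚ_[2]) ^ (padicValNat 2 W.tamagawaProduct) *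
            (Nat.card (W.selmerGroupPInfty 2) : ℚ_[2]))
    (hdiv : ∀ (κ : ZpExtension ℚ 2) (γ : Field.absoluteGaloisGroup ℚ),
      κ.IsCyclotomic → κ.IsTopGenerator γ → IsCyclotomicVariable 2 γ →
      ∀ [NeZero (W.conductorNorm ℤ)] (f : CuspForm (Gamma0 (W.conductorNorm ℤ)) 2),
        IsNewformOf W f → ∀ (ϖ : ℚ), (ϖ : ℝ) * W.realPeriodRat = plusPeriod f →
      ∀ (Lplus Lminus : IwasawaAlgebra 2), IsPollackPair f 2 Lplus Lminus →
      ∀ (D : SignedSelmerDualData W κ γ 1),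
        ∃ g h : IwasawaAlgebra 2, D.charIdeal = Ideal.span {g} ∧
          iwasawaToPowerSeries 2 (g * h) =
            PowerSeries.C (ϖ : ℚ_[2]) * iwasawaToPowerSeries 2 (kobayashiL 1 Lplus Lminus)) :
    MissingUpperBoundAt W 2 := by
  have hr : W.analyticRank = 0 := analyticRank_eq_zero_of_entireLFunction_one_ne_zero W hL
  have hirr : W.HasIrreducibleModPGaloisRep 2 :=
    P2.irr_two_of_goodSS_two W ⟨hgood, by rw [ha]; exact dvd_zero _⟩
  obtain ⟨t, ht0, ht, g, h, hvg, hg0ne, hgh⟩ := exists_generator_of_signedDivisibility_two W hmod hGZK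
    hgood ha hL h12 hKim false
    (fun κ γ hκ hγ hγ' _ f hf ϖ hϖ Lp Lm hPP D ↦ by
      simpa only [Bool.false_eq_true, if_false] using hdiv κ γ hκ hγ hγ' f hf ϖ hϖ Lp Lm hPP D)
  simp only [Bool.false_eq_true, if_false] at hgh
  have htQ : ((t : ℚ) : ℚ_[2]) ≠ 0 := by exact_mod_cast ht0
  have hh0 : ((PowerSeries.constantCoeff h : ℤ_[2]) : ℚ_[2]) ≠ 0 := fun h0 ↦
    htQ (by rw [← hgh, h0, mul_zero])
  have hval := congrArg Padic.valuation hgh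
  rw [Padic.valuation_mul hg0ne hh0, Padic.valuation_ratCast, hvg] at hval
  have hhnn := valuation_coe_padicInt_nonneg _ hh0
  refine ⟨t * (W.torsionOrder : ℚ) ^ 2 / (W.tamagawaProduct : ℚ),
    shaAn_eq_of_analyticRank_eq_zero W hGZK hr ht, ?_⟩
  rw [padicValRat_shaAn_witness W 2 hirr ht0]
  linarith

end Halves

/-! ## The refined class-level form: one-sided signed halves at `a₂ = 0`, Miller halves at `a₂ = ±2` -/

section ClassLevel

/-- **THE CRUX FROM ONE-SIDED TYPED SIGNED INPUTS AT `2`** (refines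
`supersingularRankZeroAtTwo_of_kobayashiMainConjecture_two_of_missingPPartAt`: the main-conjecture
EQUALITY is replaced by its two one-sided halves, each a weaker hypothesis). On `a₂ = 0`: PUB
{modularity, GZK} + typed {Kobayashi 1.2 at `2`, Kim 3.15 at `2`, `KobayashiLowerDivisibility W 2 1`
(Eisenstein side), the Kato-side divisibility at `2` (inline)}; on `a₂ = ±2`: the two Miller halves
`MissingLowerBoundAt W 2`, `MissingUpperBoundAt W 2` themselves (MATH-BOUND — no signed object at `2`
in print, Sprung 2012 §7). These are EXACTLY the BC3 skeleton's `stub_lower` / `stub_upper`, with the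
`a₂ = 0` sub-class of each discharged modulo named typed inputs on real objects. Composition
certificate; nothing asserted. [cite: Kobayashi2003, Thm. 1.2, Thm. 4.1 and Conjecture (p. 2)]
[cite: BDKim2013, Cor. 3.15 (p. 199)] [cite: Sprung2012, §7 (p. 1499)] [cite: Miller2011LMS, Def. 1.1] -/
theorem supersingularRankZeroAtTwo_of_signedHalves_two
    (hmod : nonempty_modularParametrizationData) (hmod' : hasEntireLFunction_rat)
    (hGZK : rank_eq_analyticRank_of_analyticRank_le_one)
    (h12 : ∀ (W : WeierstrassCurve ℚ) [W.IsElliptic] [W.IsGloballyMinimal],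
      ¬ W.HasCM → W.analyticRank = 0 → GoodSS W 2 → W.frobeniusTrace 2 = 0 →
      ∀ (κ : ZpExtension ℚ 2) (γ : Field.absoluteGaloisGroup ℚ),
        κ.IsCyclotomic → κ.IsTopGenerator γ →
        ∀ D : SignedSelmerDualData W κ γ 1,
          Module.Finite (IwasawaAlgebra 2) D.X ∧ Module.IsTorsion (IwasawaAlgebra 2) D.X)
    (hKim : ∀ (W : WeierstrassCurve ℚ) [W.IsElliptic] [W.IsGloballyMinimal],
      ¬ W.HasCM → W.analyticRank = 0 → GoodSS W 2 → W.frobeniusTrace 2 = 0 →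
      ∀ (κ : ZpExtension ℚ 2) (γ : Field.absoluteGaloisGroup ℚ),
        κ.IsCyclotomic → κ.IsTopGenerator γ →
        ∀ (D : SignedSelmerDualData W κ γ 1) [Module.Finite (IwasawaAlgebra 2) D.X],
          Module.IsTorsion (IwasawaAlgebra 2) D.X →
        ∀ g : IwasawaAlgebra 2, D.charIdeal = Ideal.span {g} → Finite (W.selmerGroupPInfty 2) →
          ∃ u : ℤ_[2]ˣ, ((PowerSeries.constantCoeff g : ℤ_[2]) : ℚ_[2]) =
            ((u : ℤ_[2]) : ℚ_[2]) * ((2 : ℕ) : ℚ_[2]) ^ (padicValNat 2 W.tamagawaProduct) *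
              (Nat.card (W.selmerGroupPInfty 2) : ℚ_[2]))
    (hlow : ∀ (W : WeierstrassCurve ℚ) [W.IsElliptic] [W.IsGloballyMinimal],
      ¬ W.HasCM → W.analyticRank = 0 → GoodSS W 2 → W.frobeniusTrace 2 = 0 →
        KobayashiLowerDivisibility W 2 1)
    (hup : ∀ (W : WeierstrassCurve ℚ) [W.IsElliptic] [W.IsGloballyMinimal],
      ¬ W.HasCM → W.analyticRank = 0 → GoodSS W 2 → W.frobeniusTrace 2 = 0 →
      ∀ (κ : ZpExtension ℚ 2) (γ : Field.absoluteGaloisGroup ℚ),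
        κ.IsCyclotomic → κ.IsTopGenerator γ → IsCyclotomicVariable 2 γ →
        ∀ [NeZero (W.conductorNorm ℤ)] (f : CuspForm (Gamma0 (W.conductorNorm ℤ)) 2),
          IsNewformOf W f → ∀ (ϖ : ℚ), (ϖ : ℝ) * W.realPeriodRat = plusPeriod f →
        ∀ (Lplus Lminus : IwasawaAlgebra 2), IsPollackPair f 2 Lplus Lminus →
        ∀ (D : SignedSelmerDualData W κ γ 1),
          ∃ g h : IwasawaAlgebra 2, D.charIdeal = Ideal.span {g} ∧
            iwasawaToPowerSeries 2 (g * h) =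
              PowerSeries.C (ϖ : ℚ_[2]) * iwasawaToPowerSeries 2 (kobayashiL 1 Lplus Lminus))
    (hL2 : ∀ (W : WeierstrassCurve ℚ) [W.IsElliptic] [W.IsGloballyMinimal],
      ¬ W.HasCM → W.analyticRank = 0 → GoodSS W 2 →
        (W.frobeniusTrace 2 = 2 ∨ W.frobeniusTrace 2 = -2) → MissingLowerBoundAt W 2)
    (hU2 : ∀ (W : WeierstrassCurve ℚ) [W.IsElliptic] [W.IsGloballyMinimal],
      ¬ W.HasCM → W.analyticRank = 0 → GoodSS W 2 →
        (W.frobeniusTrace 2 = 2 ∨ W.frobeniusTrace 2 = -2) → MissingUpperBoundAt W 2) :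
    Summit.BirchSwinnertonDyer.BirchSwinnertonDyer.Theses.ByReductionTypeAtTwo.SupersingularRankZeroAtTwo := by
  unfold Summit.BirchSwinnertonDyer.BirchSwinnertonDyer.Theses.ByReductionTypeAtTwo.SupersingularRankZeroAtTwo
  intro W _ _ hcm hr hss
  refine bsdp_of_missingPPartAt W 2 hGZK (by omega) (missingPPartAt_of_lower_of_upper W 2 ?_ ?_)
  · rcases frobeniusTrace_two_eq_zero_or W hss.1 hss.2 with ha | ha2
    · have hL : W.entireLFunction 1 ≠ 0 := (W.analyticRank_eq_zero_iff_holds (hmod' W)).1 hr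
      exact missingLowerBoundAt_two_of_kobayashiLowerDivisibility_two W hmod hGZK hss.1 ha hL
        (h12 W hcm hr hss ha) (hKim W hcm hr hss ha) (hlow W hcm hr hss ha)
    · exact hL2 W hcm hr hss ha2
  · rcases frobeniusTrace_two_eq_zero_or W hss.1 hss.2 with ha | ha2
    · have hL : W.entireLFunction 1 ≠ 0 := (W.analyticRank_eq_zero_iff_holds (hmod' W)).1 hr
      exact missingUpperBoundAt_two_of_signedUpperDivisibility_two W hmod hGZK hss.1 ha hL
        (h12 W hcm hr hss ha) (hKim W hcm hr hss ha) (hup W hcm hr hss ha)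
    · exact hU2 W hcm hr hss ha2

end ClassLevel

end Summit.BirchSwinnertonDyer.BirchSwinnertonDyer.Theorems

end
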